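import Literature.MathematicalPhysics.QuantumFieldTheory.Balaban1983to89.B9Ineq347CoReading
import Literature.MathematicalPhysics.QuantumFieldTheory.Balaban1983to89.B9RWSums343to347Whole

/-!
# `Balaban1983to89.B9Ineq347CoReadingBridge` — the two (3.47) co-readings of the N06 knit are ONE species: n06-k's
# `B9RWSums343to347Whole.GlobReads` (rows 18–19) ⇄ `B9Ineq347CoReading.CoReadsGlob` (rows 20–21)

T. Bałaban, *Propagators for lattice gauge theories in a background field*, Commun. Math. Phys. **99** (1985) 389–434
[`Balaban1985BackgroundPropagators`, "B9"].

statement-level skeleton of published theorems with citation tags; proofs where landed; nothing here is a claim about the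
Yang–Mills mass gap

THE PRINTED LOCUS.  (3.41) p. 397 *"the norm |A|_{(α)} can be defined as the smallest number C such, that |A(b)| ≦ C(Lʲη)^α for b ∈ Ω_j∖Ω_{j+1}"*;
(3.47) p. 398.

WHY THIS FILE (bookkeeping; located duplication).  Two seats typed the same (3.47) co-reading of a kernel family by a model operator on total block
maps: n06-k's `GlobReads K n U bu bv ev T` (`B9RWSums343to347Whole`, the currency of the N06 knit for rows 18–19: binders `hgl0 …`; its `obs` bound reads
`c·(L^{j(x)}η)^{p_n+γ}` as ONE real power, and it carries `wnorm_nonneg`) and this seat's `CoReadsGlob K n U bu bv ev A` (`B9Ineq347CoReading`, the input of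
`glob_of_hasMajorantHom` with a GENERIC (2.61) constant, consumed by the row-20∕21 leaves `…B9Thm312WholeLeafCoGlob` ∕ `…B9Thm313WholeLeafCoGlob`; its `obs`
bound reads `C·[(L^jη)², L^jη, L^jη, 1]_n·(L^jη)^γ`).  For positive scale lengths the two packagings agree (`t^{p_n}·t^γ = t^{p_n+γ}`, t > 0), so the
knit can take ONE species at its interface — `GlobReads`, already there — and feed the row-20∕21 leaves through ★ `coReadsGlob_of_globReads`; the converse
`globReads_of_coReadsGlob` (given |·|_{(γ)} ≧ 0) records that nothing is lost.  The instance seat discharges `GlobReads` once per model letter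
(pattern: `B9Ineq347CoReadingAtLetters.coReadsGlob_zero_kernelFamilyB` + this bridge).

HONEST SCOPE.  Pure bookkeeping between two hypothesis schemas of the cell; nothing of [B9] asserted; count-neutral; N06 NOT discharged; nothing
continuum, nothing about the mass gap.  Cell `pub-ymgap` (HUMAN RULING D-0062), Track A node N06 [B9], seat `pub-ymgap-dag-n06-l` (g3), 2026-08-27.
-/

namespace Literature.MathematicalPhysics.QuantumFieldTheory.Balaban1983to89.B9Ineq347CoReadingBridge

open B9Ineq347CoReading (CoReadsGlob)
open B9RWSums343to347Whole (GlobReads)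
open B9Ineq347AllEntries (pref4_mul_rpow)

noncomputable section

variable {g : B9.Geometry} {B : B9.Backgrounds} {u v : Type}

/-- ★ **n06-k's `GlobReads` GIVES `CoReadsGlob`** (positive scale lengths): the knit keeps ONE (3.47) co-reading species at its interface and feeds the
row-20∕21 leaves through this lemma. [cite: Balaban1985BackgroundPropagators, (3.41) p.397 + (3.47) p.398, bookkeeping] -/
theorem coReadsGlob_of_globReads {K : B9.KernelFamily g B} {n : Fin 4} {U : B.Cfg} {bu : u → g.Site} {bv : v → g.Site}
    {ev : g.Loc → v → ℝ} {T : (v → ℝ) →ₗ[ℝ] (u → ℝ)} (hlen : ∀ y : g.Site, 0 < g.len y) (h : GlobReads K n U bu bv ev T) :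
    CoReadsGlob K n U bu bv ev T where
  wbound := h.wbound
  obs := fun lam γ C hC hx => h.obs lam γ C hC fun x => by
    have h1 := hx x
    rwa [mul_assoc, pref4_mul_rpow _ γ (hlen (bu x)) n] at h1

/-- the converse: `CoReadsGlob` with |·|_{(γ)} ≧ 0 gives `GlobReads` — the two schemas are equivalent on positive scale lengths.
[cite: Balaban1985BackgroundPropagators, (3.41) p.397 + (3.47) p.398, bookkeeping] -/
theorem globReads_of_coReadsGlob {K : B9.KernelFamily g B} {n : Fin 4} {U : B.Cfg} {bu : u → g.Site} {bv : v → g.Site}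
    {ev : g.Loc → v → ℝ} {T : (v → ℝ) →ₗ[ℝ] (u → ℝ)} (hlen : ∀ y : g.Site, 0 < g.len y) (hw : ∀ (lam : g.Loc) (γ : ℝ), 0 ≤ g.wNorm γ lam)
    (h : CoReadsGlob K n U bu bv ev T) : GlobReads K n U bu bv ev T where
  wbound := h.wbound
  wnorm_nonneg := hw
  obs := fun lam γ c hc hx => h.obs lam γ c hc fun x => by
    have h1 := hx x
    rwa [← pref4_mul_rpow _ γ (hlen (bu x)) n, ← mul_assoc] at h1

end

end Literature.MathematicalPhysics.QuantumFieldTheory.Balaban1983to89.B9Ineq347CoReadingBridge
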